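import Mathlib
import Summits.BirchSwinnertonDyer.BirchSwinnertonDyer.Theorems.ManinLocalTwoThreeEvenDegreeOfFrickeSignPlus
import Summits.BirchSwinnertonDyer.BirchSwinnertonDyer.Theorems.ManinLocalTwoThreeCuspThreeTorsionAtFour
import Literature.NumberTheory.EllipticCurves.AtkinLehnerProductProofs
import HarnessLib

/-!
# `N = 4p`, `w_p f = −f` (root number `−1`): `w_N f = f`, `{∞,0}_f = 0`, `{∞,¼}_f ∈ Λ_f`, `{∞,1/p}_f ∈ Λ_f`, even degree

Summit `BirchSwinnertonDyer`, sub-problem `BirchSwinnertonDyer`, route `ManinLocalTwoThree`; width seat `bsd-line-manin23-p2`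
(gen 9), `--supports` the crux C2 `ManinOddAtFour` (stmt-BirchSwinnertonDyer-22967).  Cell `bsd-f2-manin`, an lens THEOREM A/B/C
package at `N = 4p` (leaf `HalfTranslationParity`, E-an-79 `FourPThreeModFourEvenDegree`: «even degree and `{∞,¼} ∈ Λ_f`»).  Here
the `w_p`-sign `−1` half, for EVERY prime `p ≠ 2` and every datum: `ε₄ = −1` always (seat gen 8, E-an-44), so `w_p f = −f` makes
the Fricke sign `ε_N = ε₄ ε_p = +1` (`frickeEigenvalue_eq_prod_atkinLehnerEigenvalueAt_of_forall`); then `{∞,0}_f = 0`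
(`modularSymbol_zero_eq_zero_of_frickeInvolution_eq_self`) and `2 ∣ deg φ_D` (`two_dvd_modularDegree_of_frickeInvolution_eq_self`,
p659653); and the cusp hexagon (E-an-83, `fourPCuspHexagon_holds`: `{∞,0} ≡ {∞,¼} + {∞,1/p}`, `2{∞,¼} ∈ Λ`, `3{∞,1/p} ∈ Λ`)
forces `{∞,¼}_f ∈ Λ_f` and `{∞,1/p}_f ∈ Λ_f`: ALL six hexagon cusps map to `O`.

PROVED here (no `sorry`): `factorization_two_four_mul`, `atkinLehnerEigenvalueAt_two_eq_neg_one_four_mul`,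
`frickeInvolution_eq_self_of_atkinLehnerInvolutionAt_p_eq_neg`, **`fourP_cusps_of_atkinLehner_p_eq_neg`** (the four conclusions).
BSD is not proved by this; Manin's conjecture is not proved by this.
-/

set_option autoImplicit false
set_option linter.dupNamespace false

noncomputable section

open scoped MatrixGroups ModularForm
open CongruenceSubgroup
open Literature.NumberTheory.EllipticCurves Literature.NumberTheory.EllipticCurves.ModularForms
open Summit.BirchSwinnertonDyer.Rank1Residual.ManinAdditive

namespace Summit.BirchSwinnertonDyer.BirchSwinnertonDyer.Theorems.ManinLocalTwoThree

/-- `v₂(4p) = 2` for an odd prime `p`, i.e. `2^{v₂(4p)} = 4`. -/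
theorem factorization_two_four_mul {p : ℕ} (hp : p.Prime) (hp2 : p ≠ 2) : 2 ^ (4 * p).factorization 2 = 4 := by
  have h1 : (4 * p).factorization 2 = 2 := by
    rw [show 4 * p = 2 ^ 2 * p by norm_num, Nat.factorization_mul (by norm_num) hp.ne_zero, Finsupp.add_apply,
      Nat.Prime.factorization_pow Nat.prime_two, Finsupp.single_eq_same,
      Nat.factorization_eq_zero_of_not_dvd (fun h => hp2 ((Nat.prime_dvd_prime_iff_eq Nat.prime_two hp).mp h).symm),
      add_zero]
  rw [h1]; norm_num

/-- **`λ₂ = −1` at `N = 4p`** (`w_{Q_2} = w_4` acts by `−1` on every newform, E-an-44). -/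
theorem atkinLehnerEigenvalueAt_two_eq_neg_one_four_mul {p : ℕ} [NeZero (4 * p)] (hp : p.Prime) (hp2 : p ≠ 2)
    {f : CuspForm (Gamma0 (4 * p)) 2} (hf : IsNewform0 f) : atkinLehnerEigenvalueAt f 2 = -1 := by
  refine atkinLehnerEigenvalueAt_eq_of_eq_smul hf.ne_zero ?_
  rw [atkinLehnerInvolutionAt_eq (N := 4 * p) (k := 2) (factorization_two_four_mul hp hp2),
    atkinLehnerInvolution_four_eq_neg (hp.odd_of_ne_two hp2) f hf, neg_one_smul]

/-- **`w_p f = −f ⟹ w_N f = f` at `N = 4p`** (`ε_N = λ₂ λ_p = (−1)(−1)`). -/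
theorem frickeInvolution_eq_self_of_atkinLehnerInvolutionAt_p_eq_neg {p : ℕ} [NeZero (4 * p)] (hp : p.Prime) (hp2 : p ≠ 2)
    {f : CuspForm (Gamma0 (4 * p)) 2} (hf : IsNewform0 f) (hε : atkinLehnerInvolutionAt (4 * p) 2 p f = -f) :
    frickeInvolution (4 * p) 2 f = f := by
  have hlamp : atkinLehnerEigenvalueAt f p = -1 :=
    atkinLehnerEigenvalueAt_eq_of_eq_smul hf.ne_zero (by rw [hε, neg_one_smul])
  have hprod := frickeEigenvalue_eq_prod_atkinLehnerEigenvalueAt_of_forall hf.ne_zero fun q hq =>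
    (IsNewform0.exists_atkinLehnerInvolutionAt_eq_smul_holds hf (Nat.prime_of_mem_primeFactors hq)
      (Nat.dvd_of_mem_primeFactors hq)).imp fun _ h => h.2
  have hpf : (4 * p).primeFactors = {2, p} := by
    rw [show 4 * p = 2 ^ 2 * p by norm_num, Nat.primeFactors_mul (by norm_num) hp.ne_zero,
      Nat.primeFactors_prime_pow (by norm_num) Nat.prime_two, hp.primeFactors]
    rfl
  rw [hpf, Finset.prod_pair (Ne.symm hp2), atkinLehnerEigenvalueAt_two_eq_neg_one_four_mul hp hp2 hf, hlamp] at hprod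
  rw [IsNewform0.frickeInvolution_eq_smul_holds hf, hprod]
  norm_num

/-- **`N = 4p`, `w_p f_D = −f_D` (root number `−1`): all hexagon cusps map to `O` and the degree is even** —
`{∞,0}_f = 0`, `{∞,¼}_f ∈ Λ_f`, `{∞,1/p}_f ∈ Λ_f`, `2 ∣ deg φ_D`, for every datum `D` of every curve. -/
theorem fourP_cusps_of_atkinLehner_p_eq_neg {p : ℕ} [NeZero (4 * p)] (hp : p.Prime) (hp2 : p ≠ 2)
    {W : WeierstrassCurve ℚ} [W.IsElliptic] (D : ModularParametrizationData W (4 * p))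
    (hε : atkinLehnerInvolutionAt (4 * p) 2 p D.f = -D.f) :
    modularSymbol D.f 0 = 0 ∧ modularSymbol D.f (1 / 4 : ℚ) ∈ periodLattice D.f ∧
      modularSymbol D.f (1 / p : ℚ) ∈ periodLattice D.f ∧ 2 ∣ D.modularDegree := by
  have hF := frickeInvolution_eq_self_of_atkinLehnerInvolutionAt_p_eq_neg hp hp2 D.isNewformOf.1 hε
  have h0 : modularSymbol D.f 0 = 0 := modularSymbol_zero_eq_zero_of_frickeInvolution_eq_self hF
  have hN1 : 4 * p ≠ 1 := by have := hp.two_le; omega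
  obtain ⟨h2, h3, hhex, -, -⟩ := fourPCuspHexagon_holds W D p hp hp2 rfl
  rw [h0, zero_sub] at hhex
  -- `-{∞,¼} - {∞,1/p} ∈ Λ`, `2{∞,¼} ∈ Λ`, `3{∞,1/p} ∈ Λ` ⟹ both symbols in `Λ`
  set q := modularSymbol D.f (1 / 4 : ℚ) with hq
  set r := modularSymbol D.f (1 / p : ℚ) with hr
  have hq_mem : q ∈ periodLattice D.f := by
    -- `q = 3(q + r) - 2q·1 ... `: `q = -(2q) - 3(-q - r) - 3r + ... ` explicit: `q = 3*(-q - r) + 2*(2*q) + 3*r`?  check: -3q-3r+4q+3r = q ✓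
    have := (periodLattice D.f).add_mem
      ((periodLattice D.f).add_mem ((periodLattice D.f).zsmul_mem hhex 3) ((periodLattice D.f).zsmul_mem h2 2))
      ((periodLattice D.f).zsmul_mem h3 1)
    convert this using 1
    simp only [zsmul_eq_mul]; push_cast; ring
  have hr_mem : r ∈ periodLattice D.f := by
    have := (periodLattice D.f).sub_mem ((periodLattice D.f).neg_mem hhex) hq_mem
    convert this using 1
    ring
  exact ⟨h0, hq_mem, hr_mem, two_dvd_modularDegree_of_frickeInvolution_eq_self hN1 D hF⟩

end Summit.BirchSwinnertonDyer.BirchSwinnertonDyer.Theorems.ManinLocalTwoThree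

end
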